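import Summits.QuantumFields.YangMills.Theorems.BalabanUVNodesRateReadingOfRecord13CoPH
import Literature.MathematicalPhysics.QuantumFieldTheory.Balaban1983to89.Node00.HistoryRecursionOfRecord
import HarnessLib

/-!
# BalabanUVNodes ∕ node N18 = NE5 — THE DISPLAYED NONDEGENERACY GUARD OF NODE U3's OBJECT TOWER «COUPLING-SENSITIVE (in particular NON-ZERO) OVER THE
# RECORD's BOXES», WHAT THE (D4) READ-OUT BINDERS CERTIFY ABOUT IT, AND A LOCATED FINDING: (D4) KEYED AT ONE RUN LENGTH OF A RUN-TOWER W1 READING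
# DEGENERATES THE DATUM's β ABOVE THAT RUN LENGTH (at run length 0 the level functional IS the zero functional)

Cell `pub-ymgap`, width seat `pub-ymgap-dag-n18-w2` (HUMAN RULING D-0149 ∕ director-ym №197; plan g77 `W-SEAT-START-LIST` v3 §n18 ITEM 2 «NON-ZERO U3 OBJECT
TOWER of record over the record's boxes (plan guard; record names of `EA∕EB` → (q2)∕(q3) input)»).  `--supports stmt-QuantumFields-20544` (K3⁷ `SpineGivenEndpointR13SepCoPH`)
AS A HELPER — count-neutral.  Definition lane by content: four hypothesis SHAPES (`def … : Prop`, asserted for nothing) + kernel bookkeeping over tree declarations BY NAME.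

CONTEXT (plan g77 YMPLAN-G77-K3STUB1-DECISION, pub-ymgap INBOX l.23415; K3 v2 DRAFT `pub-ymgap-plan/D77-K3V2-draft/`).  dag-n18-e's evidence #5 on the K3⁷ item
(`K3Stub1ShadowSepCoPH.lean`) inhabits the v1 stub `stub_rates13` with node U3's functionals `EA ≡ 0`, `EB ≡ 0` (`junkU3`) and, with honest letters, with KING's
COUPLING-BLIND `A = 0` graphs (`keyedRates_kingModel`) — «only a tie of `u3.EA ∕ EB` to the datum ((D4) `ReadOutAt`, or the record predicate) can» bind the stub to the
record.  The v2 draft therefore keys `PHolderD4 β D R := RatesHolderAt D R β ∧ ReadOutAt D R.u3` at THE BUNDLE OF RECORD `rateCarriersOfRecord₁₃CoPH 𝔯 F θ hP g₀ os (ksel …)`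
and asks (q3) «does (D4) close the zero-functional door on its own modulo “β₁₃ constant on a box”, else name the extra conjunct», and, at the fallback, for
«plan-typed nondegeneracy guards … where `∃ 𝔯` stands».  THIS FILE types node U3's guard and settles, in the kernel, what (D4) does and does not certify about it.

WHAT IS DECLARED ∕ PROVED.
* §1 THE GUARDS (shapes over `T4OutputRate.Functional` ∕ `FlowStep.HBeta`): `BlindOnBoxes E γ` (the frozen-coupling SLICES `E (extd v)`, `E (extd v')` at any two histories
  of the same box `]0,γ]^{k+1}` COINCIDE — satisfied by the zero functionals AND by every coupling-blind functional, e.g. King's model), its run-B twin `BlindOnBoxesB EB γ`,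
  ★ THE GUARD `SensitiveOnBoxes E γ := ∃` a step and two box histories whose slices DIFFER (`↔ ¬ BlindOnBoxes`, so it EXCLUDES both of evidence #5's inhabitants; it is
  the U3 analogue of RR-1's `Populated` displays — necessary for content, never sufficient), and the β-degeneracy shape `BoxwiseConstant γ β` (each `β k` constant on
  its box).  Faces at the bundle of record `u3OfRecord₁₃ θ u k` (the guard reads the level functional `u.EA k` on `Box θ.γ`, `Iff.rfl`) and at n22-e's reading of record
  `readingOfRecord₁₃CoPH w1 ℓ₃ ne2 ne1` — THE RECORD NAMES OF `EA ∕ EB` (`rfl`): `EA k g U ⟨j,X⟩ = Re E^{(j)}(X; g; embA U) = (W1.functionalC ((w1 F θ).S k) g (embA U) ⟨j,X⟩).re`,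
  `EB k b g U X = (W1.functionalC ((w1 F θ).S (k+1)) (b∷g) (embB U) (pair X)).re`; the guard there reads «some (2.13) term of the run-`k` tower distinguishes two box histories».
* §2 WHAT (D4) CERTIFIES (kernel; plan (q3)): `RepresentsA` + `BlindOnBoxes` ⇒ `BoxwiseConstant` (per step; `RepresentsB` twin one step up); hence
  ★ `boxwiseConstant_of_readOutAt_blind` and its contrapositive ★★ `sensitiveOnBoxes_of_readOutAt`: UNDER (D4) THE GUARD IS A COROLLARY OF «β NOT boxwise constant» — and
  (D4) certifies NOTHING ELSE about the tower: `readOutAt_of_boxwiseConst` — at a datum whose β IS boxwise ONE constant, EVERY U3 tower with `cr = 0` (zero, blind or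
  genuine) passes (D4) (constant recipes).  So the residual of l.23415 (q3) is EXACT: (D4) separates junk from content precisely to the extent that `betaOfRecord₁₃` is
  non-degenerate on the boxes — a property of a `limUnder` object (`Node00/BetaOfRecord`), NODE O's, not decidable here.  (dag-n17-w2's §n17 item 2 types the ZERO-functional
  test and the β-encoding bound; not restated.)
* §3 LOCATED — (D4) AT A PER-RUN-LENGTH BUNDLE OF A RUN-TOWER W1 READING (kernel).  For W1 reading data `Dw : ReadingData F 𝔸 M` whose run-length-`k` tower creates no
  term after step `k` (`W1.TermlessBeyond (Dw.S k) k` — EVERY `W1.runTowers S′`, `termlessBeyond_runTowers`; [Balaban1987RG1] (0.23): a run of `k` steps creates the terms of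
  steps `1, …, k` and no others): (a) `EA_eq_of_agree_below` — the level-`k` slices at two histories agreeing BELOW `k` coincide (prefix dependence `termC_congr_prefix` +
  truncation); (b) `EA_level_zero_eq_zero` — AT RUN LENGTH 0 THE LEVEL FUNCTIONAL IS THE ZERO FUNCTIONAL (the level-0 bundle of every run-tower reading IS evidence #5's
  zero tower on W1 carriers; `not_sensitiveOnBoxes_level_zero`: the guard can only be asked at a level `k ≥ 1`); (c) ★★ `beta_eq_of_readOutAt_runLevel` — `ReadOutAt D
  (u3OfRecord₁₃ θ (Dw.u3Objects γℓ) k)` forces, at EVERY step `k′`, `D.βfun k′ v = D.βfun k′ v'` for box histories agreeing on the coordinates `< k`: β at steps `k′ ≥ k` is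
  BLIND TO `g_k, …, g_{k′}`, in particular to ITS LAST COUPLING (`…_of_agree_fin`); at `k = 0`: `BoxwiseConstant θ.γ D.βfun`; (d) ★★ `boxwiseConstant_of_s_D4_readingOfRecord₁₃CoPH`
  — the seventh K4 stub `S_D4 (RRec₁₃CoPH (readingOfRecord₁₃CoPH w1 ℓ₃ ne2 ne1))` at a run-tower reading (the predicate pins run length 0 too) says «at every Stage-13 datum
  key the datum's β is constant on every box»; θ-form `boxwiseConstant_betaOfRecord₁₃_of_readOutAt_level_zero`.
  READING for (q1)∕(q3)∕R2: `RepresentsA` reads EVERY step of β off ONE functional, so the (D4)-compatible U3 object is a tower whose ONE carrier holds the creation steps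
  of EVERY run (the shape of `T4BetaReadOutWitness.toyC`: domains at all scales) — not a run-length level of `W1.ReadingData.u3Objects`; keyed at `u3OfRecord₁₃ θ (𝔯.lit …).u3
  (ksel …)` with a run-tower `𝔯`, the v2 conjunct `ReadOutAt` is satisfiable only by a β₁₃ degenerate above the selected run length.

A6 (№189) — SATISFIABILITY OF THE DISPLAYED HYPOTHESES.  §2's binders are jointly inhabited by `readOutAt_of_boxwiseConst` itself (any bundle with `cr = 0` at a
datum with boxwise-constant β); §3's `TermlessBeyond (Dw.S k) k` holds for every `W1.runTowers S′ k` (`W1.termlessBeyond_runTowers`); §3's `ReadOutAt … (level k)` ∧ run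
tower is inhabited EXACTLY at data degenerate above `k` (by §2's converse with the level-`k` bundle, `cr = 0`) — which is the finding: these theorems are VACUITY
CERTIFICATES for a binder placement, labelled LOCATED, never discharges.

HONEST FRAMING.  Shapes + bookkeeping; NOTHING of Bałaban's is asserted; NE5 ∕ NE9 ∕ (D4) are NOT PRINTED beyond the linearity of [Balaban1987RG1] (1.20)–(1.22) p. 264
(node U2 ∕ U3 of the cell's T4-DAG) and NOT proved; the towers `(w1 F θ).S k` are RESIDUAL reading data; §3 is a located VACUITY finding about a binder placement (A6 class),
not a refutation of any item; N18 NOT discharged; K3⁷ OPEN, not claimed; counts UNMOVED (typed 28∕28 · discharged 5∕27 (A 5∕28)).  One finite four-torus programme at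
fixed `ε`, Bałaban as printed; R4 closes the conditional finite-𝕋⁴ rung `BalabanLadder.UV` only — NOT ℝ⁴, NOT infinite volume, NOT OS, NOT a mass gap, NOT Clay.
No `sorry`, no `instance`, no `notation`, no `structure`.
-/

set_option autoImplicit false

noncomputable section

namespace YMDAG.N18.U3Guards

open Literature.MathematicalPhysics.QuantumFieldTheory.Balaban1983to89
open Literature.MathematicalPhysics.QuantumFieldTheory.Balaban1983to89.T4Continuum
open Literature.MathematicalPhysics.QuantumFieldTheory.Balaban1983to89.FlowStep (Box HBeta mem_box)
open Literature.MathematicalPhysics.QuantumFieldTheory.Balaban1983to89.T4FlagMemory (extd extd_coe)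
open Literature.MathematicalPhysics.QuantumFieldTheory.Balaban1983to89.T4OutputRate (Carriers Functional Window)
open Literature.MathematicalPhysics.QuantumFieldTheory.Balaban1983to89.T4BetaReadOut (RepresentsA RepresentsB Slice ReadOut SliceClose)
open Literature.MathematicalPhysics.QuantumFieldTheory.Balaban1983to89.T4BetaReadOutLipschitz (ReadBoundedOn ReadCovariantOn)
open Literature.MathematicalPhysics.QuantumFieldTheory.Balaban1983to89.Node00 (Stage13Params Stage13HParams IsDatumOfRecord₁₃CCoPH datumOfRecord₁₃CoPH
  betaOfRecord₁₃ U3Objects₁₁ NE3Letters₁₁ NE2Objects₁₁ prependCoupling MatA)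
open Literature.MathematicalPhysics.QuantumFieldTheory.Balaban1983to89.Node00.W1 (ReadingData TermlessBeyond termC termC_zero termC_congr_prefix functionalC)
open YMDAG.UVSplit

/-! ## §1 The displayed guards -/

section Shapes

variable {C : Carriers} {Bg : Type}

/-- **COUPLING-BLIND OVER THE γ-BOXES** (shape): for every step `k` and any two histories `v, v'` in the box `]0,γ]^{k+1}` the frozen-coupling SLICES of `E` at the
padded histories `extd v`, `extd v'` COINCIDE (as functions of background and domain).  Satisfied by the ZERO functionals (evidence #5's `junkU3`) and by every
coupling-blind functional (King's `A = 0` model).  Asserted for nothing. [folklore] -/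
@[folklore]
def BlindOnBoxes (E : Functional C Bg) (γ : ℝ) : Prop :=
  ∀ (k : ℕ) (v v' : Fin (k + 1) → ℝ), v ∈ Box γ k → v' ∈ Box γ k → E (extd v) = E (extd v')

/-- **RUN B's TWIN**: the first-coupling family is blind in (unpaired first coupling, re-indexed history) over the boxes `]0,γ]^{k+2}` — the arguments
`RepresentsB` reads. [folklore] -/
@[folklore]
def BlindOnBoxesB (EB : ℝ → Functional C C.BgB) (γ : ℝ) : Prop :=
  ∀ (k : ℕ) (w w' : Fin (k + 2) → ℝ), w ∈ Box γ (k + 1) → w' ∈ Box γ (k + 1) →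
    EB (w 0) (extd (Fin.tail w)) = EB (w' 0) (extd (Fin.tail w'))

/-- **THE GUARD — COUPLING-SENSITIVE (in particular NON-ZERO) OVER THE γ-BOXES** (shape): SOME step and two box histories whose frozen-coupling slices DIFFER.
The U3 analogue of RR-1's `Populated` displays (`Node00/RateRecord11` §8): NECESSARY for a contentful node-U3 tower (it excludes the zero and the coupling-blind towers),
never sufficient. [folklore] -/
@[folklore]
def SensitiveOnBoxes (E : Functional C Bg) (γ : ℝ) : Prop :=
  ∃ (k : ℕ) (v v' : Fin (k + 1) → ℝ), v ∈ Box γ k ∧ v' ∈ Box γ k ∧ E (extd v) ≠ E (extd v')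

/-- **β DEGENERATE ON THE BOXES** (shape): every `β k` is constant on its box `]0,γ]^{k+1}` (the constants may depend on `k`). [folklore] -/
@[folklore]
def BoxwiseConstant (γ : ℝ) (β : HBeta) : Prop :=
  ∀ (k : ℕ) (v v' : Fin (k + 1) → ℝ), v ∈ Box γ k → v' ∈ Box γ k → β k v = β k v'

/-- The guard IS the negation of blindness. [folklore] -/
theorem sensitiveOnBoxes_iff_not_blindOnBoxes (E : Functional C Bg) (γ : ℝ) : SensitiveOnBoxes E γ ↔ ¬ BlindOnBoxes E γ := by
  unfold SensitiveOnBoxes BlindOnBoxes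
  push Not
  rfl

/-- The ZERO functional is blind (evidence #5's `junkU3` FAILS the guard). [folklore] -/
theorem blindOnBoxes_of_forall_eq_zero {E : Functional C Bg} (h : ∀ g U X, E g U X = 0) (γ : ℝ) : BlindOnBoxes E γ :=
  fun _ _ _ _ _ => funext fun U => funext fun X => by rw [h, h]

/-- Every COUPLING-BLIND functional is blind (King's `A = 0` model, `keyedRates_kingModel`'s `hblind`, FAILS the guard). [folklore] -/
theorem blindOnBoxes_of_couplingBlind {E : Functional C Bg} (h : ∀ (g g' : ℕ → ℝ) (U : Bg) (X : C.Dom), E g U X = E g' U X) (γ : ℝ) :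
    BlindOnBoxes E γ :=
  fun _ _ _ _ _ => funext fun U => funext fun X => h _ _ U X

/-- Run B: a family blind in both arguments is blind over the boxes. [folklore] -/
theorem blindOnBoxesB_of_couplingBlind {EB : ℝ → Functional C C.BgB}
    (h : ∀ (b b' : ℝ) (g g' : ℕ → ℝ) (U : C.BgB) (X : C.Dom), EB b g U X = EB b' g' U X) (γ : ℝ) : BlindOnBoxesB EB γ :=
  fun _ _ _ _ _ => funext fun U => funext fun X => h _ _ _ _ U X

/-- A blind functional does not pass the guard. [folklore] -/
theorem not_sensitiveOnBoxes_of_blind {E : Functional C Bg} {γ : ℝ} (h : BlindOnBoxes E γ) : ¬ SensitiveOnBoxes E γ :=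
  fun hs => ((sensitiveOnBoxes_iff_not_blindOnBoxes E γ).mp hs) h

/-- `BoxwiseConstant` as «one constant per step». [folklore] -/
theorem boxwiseConstant_iff_exists_const (γ : ℝ) (β : HBeta) :
    BoxwiseConstant γ β ↔ ∀ k, ∃ c : ℝ, ∀ v, v ∈ Box γ k → β k v = c := by
  constructor
  · intro h k
    by_cases hne : ∃ v₀, v₀ ∈ Box γ k
    · obtain ⟨v₀, hv₀⟩ := hne
      exact ⟨β k v₀, fun v hv => h k v v₀ hv hv₀⟩
    · exact ⟨0, fun v hv => absurd ⟨v, hv⟩ hne⟩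
  · intro h k v v' hv hv'
    obtain ⟨c, hc⟩ := h k
    rw [hc v hv, hc v' hv']

end Shapes

/-! ## §2 What the (D4) read-out binders certify about the guard (kernel) -/

section ReadOutShapes

variable {C : Carriers} {Bg : Type}

/-- **`RepresentsA` + BLIND ⇒ β BOXWISE CONSTANT**: `β k v = r k (E (extd v)) = r k (E (extd v')) = β k v'`. [folklore] -/
theorem boxwiseConstant_of_representsA_blind {E : Functional C Bg} {r : ReadOut C Bg} {γ : ℝ} {β : HBeta}
    (hA : RepresentsA E r γ β) (hbl : BlindOnBoxes E γ) : BoxwiseConstant γ β :=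
  fun k v v' hv hv' => by rw [hA k v hv, hA k v' hv', hbl k v v' hv hv']

/-- **`RepresentsB` + BLIND ⇒ β CONSTANT ONE STEP UP** (on `]0,γ]^{k+2}`). [folklore] -/
theorem beta_succ_eq_of_representsB_blind {EB : ℝ → Functional C C.BgB} {rB : ReadOut C C.BgB} {γ : ℝ} {β : HBeta}
    (hB : RepresentsB EB rB γ β) (hbl : BlindOnBoxesB EB γ) {k : ℕ} {w w' : Fin (k + 2) → ℝ} (hw : w ∈ Box γ (k + 1))
    (hw' : w' ∈ Box γ (k + 1)) : β (k + 1) w = β (k + 1) w' := by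
  rw [hB k w hw, hB k w' hw', hbl k w w' hw hw']

/-- **`RepresentsA` + «β NOT boxwise constant» ⇒ THE GUARD.** [folklore] -/
theorem sensitiveOnBoxes_of_representsA {E : Functional C Bg} {r : ReadOut C Bg} {γ : ℝ} {β : HBeta}
    (hA : RepresentsA E r γ β) (hβ : ¬ BoxwiseConstant γ β) : SensitiveOnBoxes E γ :=
  (sensitiveOnBoxes_iff_not_blindOnBoxes E γ).mpr fun hbl => hβ (boxwiseConstant_of_representsA_blind hA hbl)

end ReadOutShapes

section ReadOutAtCarriers

variable {F : T4Family} {N : ℕ} [NeZero N]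

/-- **(D4) + BLIND ⇒ THE DATUM's β IS BOXWISE CONSTANT** (per step): the `RepresentsA` conjunct of `ReadOutAt D u` alone.  Covers the coupling-blind NON-ZERO towers
(King's model) as well as the zero tower. [folklore] -/
theorem boxwiseConstant_of_readOutAt_blind {D : Datum F N} {u : U3Carriers} (hD4 : ReadOutAt D u) (hbl : BlindOnBoxes u.EA u.γ) :
    BoxwiseConstant u.γ D.βfun := by
  obtain ⟨_, _, rA, _, -, hA, -⟩ := hD4
  exact boxwiseConstant_of_representsA_blind hA hbl

/-- **★ (D4) MAKES THE GUARD A COROLLARY OF β-NONDEGENERACY**: under `ReadOutAt D u`, if the datum's β is NOT boxwise constant then node U3's run-A functional is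
COUPLING-SENSITIVE over the record's boxes (hence non-zero).  This is ALL (D4) certifies about `u.EA` in this direction (see `readOutAt_of_boxwiseConst`). [folklore] -/
theorem sensitiveOnBoxes_of_readOutAt {D : Datum F N} {u : U3Carriers} (hD4 : ReadOutAt D u) (hβ : ¬ BoxwiseConstant u.γ D.βfun) :
    SensitiveOnBoxes u.EA u.γ :=
  (sensitiveOnBoxes_iff_not_blindOnBoxes u.EA u.γ).mpr fun hbl => hβ (boxwiseConstant_of_readOutAt_blind hD4 hbl)

/-- **THE CONVERSE AT A DEGENERATE DATUM — (D4) THEN CERTIFIES NOTHING ABOUT THE TOWER**: if the datum's β is ONE constant `c` on every box, then EVERY node-U3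
bundle whose window contains the padded boxes, with read-out constant `cr = 0` and the displayed letter signs, satisfies `ReadOutAt D u` — whatever its functionals
(zero, coupling-blind or genuine): take both recipes constant `c` on all slices.  Hypothesis form (no junk object is defined). [folklore] -/
theorem readOutAt_of_boxwiseConst {D : Datum F N} {u : U3Carriers} {c : ℝ}
    (hW : ∀ (k : ℕ) (v : Fin (k + 1) → ℝ), v ∈ Box u.γ k → extd v ∈ u.W)
    (hc : ∀ (k : ℕ) (v : Fin (k + 1) → ℝ), v ∈ Box u.γ k → D.βfun k v = c)
    (hcr : u.cr = 0) (hC₅ : 0 ≤ u.C₅) (hθ : 0 ≤ u.θ) (hω : 0 ≤ u.ω) (hθρ : u.θ ≤ u.ρ) (hωρ : u.ω ≤ u.ρ) :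
    ReadOutAt D u := by
  refine ⟨Set.univ, Set.univ, fun _ _ => c, fun _ _ => c, hW, fun k v hv => hc k v hv, fun k w hw => hc (k + 1) w hw,
    fun _ _ => Set.mem_univ _, fun _ _ _ _ _ => Set.mem_univ _, ?_, ?_, hcr.ge, hC₅, hθ, hω, hθρ, hωρ⟩
  · intro k F G M _ _ _
    rw [hcr, sub_self, abs_zero, zero_mul]
  · intro k F G M _ _ _
    rw [hcr, sub_self, abs_zero, zero_mul]

/-- **THE GUARD AT THE BUNDLE OF RECORD** reads the level-`k` functional on the record's boxes `]0, θ.γ]^{k′+1}` (`Iff.rfl`). [folklore] -/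
theorem sensitiveOnBoxes_u3OfRecord₁₃_iff (θ : Stage13Params F N) (u : U3Objects₁₁) (k : ℕ) :
    SensitiveOnBoxes (u3OfRecord₁₃ θ u k).EA (u3OfRecord₁₃ θ u k).γ ↔ SensitiveOnBoxes (u.EA k) θ.γ :=
  Iff.rfl

end ReadOutAtCarriers

/-! ## §3 LOCATED: (D4) at a per-run-length bundle of a run-tower W1 reading (kernel) -/

section RunTowers

variable {F : T4Family} {𝔸 : Type*} {M : ℕ}

/-- **THE LEVEL-`k` SLICES OF A RUN-TOWER READING SEE THE COUPLINGS BELOW `k` ONLY**: if the run-length-`k` tower creates no term after step `k`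
(`W1.TermlessBeyond (Dw.S k) k` — every `W1.runTowers S′ k`), two histories agreeing on the indices `< k` give the SAME level-`k` slice: a term of creation step
`j ≤ k` reads `g₀, …, g_{j−1}` (`termC_congr_prefix`), a term of creation step `j > k` vanishes. [folklore] -/
theorem EA_eq_of_agree_below (Dw : ReadingData F 𝔸 M) (γℓ : ℝ) {k : ℕ} (hT : TermlessBeyond (Dw.S k) k) {g g' : ℕ → ℝ}
    (hag : ∀ i, i < k → g i = g' i) : (Dw.u3Objects γℓ).EA k g = (Dw.u3Objects γℓ).EA k g' := by
  funext U X
  obtain ⟨j, X⟩ := X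
  rw [ReadingData.u3Objects_EA_apply, ReadingData.u3Objects_EA_apply]
  show (termC (Dw.S k) j X g _).re = (termC (Dw.S k) j X g' _).re
  by_cases hj : j ≤ k
  · rw [termC_congr_prefix (Dw.S k) j X (fun i hi => hag i (lt_of_lt_of_le hi hj))]
  · rw [hT j X g _ (lt_of_not_ge hj), hT j X g' _ (lt_of_not_ge hj)]

/-- **AT RUN LENGTH 0 THE LEVEL FUNCTIONAL IS THE ZERO FUNCTIONAL**: no term at creation step `0` (`termC_zero`), none after step `0` (run tower).  The level-`0` bundle of
every run-tower reading IS evidence #5's zero tower, on W1's carriers. [folklore] -/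
theorem EA_level_zero_eq_zero (Dw : ReadingData F 𝔸 M) (γℓ : ℝ) (hT : TermlessBeyond (Dw.S 0) 0) (g : ℕ → ℝ) (U : (Dw.pairing 0).BgA)
    (X : Node00.W1.Dom (F.P 0) M) : (Dw.u3Objects γℓ).EA 0 g U X = 0 := by
  obtain ⟨j, X⟩ := X
  rw [ReadingData.u3Objects_EA_apply]
  show (termC (Dw.S 0) j X g _).re = 0
  cases j with
  | zero => rw [termC_zero, Complex.zero_re]
  | succ j => rw [hT (j + 1) X g _ (Nat.succ_pos j), Complex.zero_re]

/-- … hence blind over every box: THE GUARD FAILS AT LEVEL 0 of a run-tower reading — it can only be asked at a selected run length `k ≥ 1`. [folklore] -/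
theorem not_sensitiveOnBoxes_level_zero (Dw : ReadingData F 𝔸 M) (γℓ γ : ℝ) (hT : TermlessBeyond (Dw.S 0) 0) :
    ¬ SensitiveOnBoxes ((Dw.u3Objects γℓ).EA 0) γ :=
  not_sensitiveOnBoxes_of_blind (blindOnBoxes_of_forall_eq_zero (EA_level_zero_eq_zero Dw γℓ hT) γ)

variable {N : ℕ} [NeZero N]

/-- **★★ (D4) KEYED AT RUN LENGTH `k` OF A RUN-TOWER READING MAKES THE DATUM's β BLIND TO THE COUPLINGS `g_i`, `i ≥ k`, AT EVERY STEP**: under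
`ReadOutAt D (u3OfRecord₁₃ θ (Dw.u3Objects γℓ) k)`, for every step `k′` and box histories `v, v' ∈ ]0,θ.γ]^{k′+1}` whose padded sequences agree on the indices `< k`,
`D.βfun k′ v = D.βfun k′ v'` — `RepresentsA` reads EVERY step of β off the ONE level-`k` functional, whose slices see the couplings below `k` only. [folklore] -/
theorem beta_eq_of_readOutAt_runLevel (θ : Stage13Params F N) (D : Datum F N) (Dw : ReadingData F 𝔸 M) (γℓ : ℝ) {k : ℕ}
    (hT : TermlessBeyond (Dw.S k) k) (hD4 : ReadOutAt D (u3OfRecord₁₃ θ (Dw.u3Objects γℓ) k))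
    {k' : ℕ} {v v' : Fin (k' + 1) → ℝ} (hv : v ∈ Box θ.γ k') (hv' : v' ∈ Box θ.γ k') (hag : ∀ i, i < k → extd v i = extd v' i) :
    D.βfun k' v = D.βfun k' v' := by
  obtain ⟨_, _, rA, _, -, hA, -⟩ := hD4
  rw [hA k' v hv, hA k' v' hv']
  show rA k' ((Dw.u3Objects γℓ).EA k (extd v)) = rA k' ((Dw.u3Objects γℓ).EA k (extd v'))
  rw [EA_eq_of_agree_below Dw γℓ hT hag]

/-- **… IN PARTICULAR β IS BLIND TO ITS LAST COUPLING AT EVERY STEP `k′ ≥ k`** (indeed to `g_k, …, g_{k′}`): agreement of the box histories on the `Fin` coordinates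
`< k` suffices. [folklore] -/
theorem beta_eq_of_readOutAt_runLevel_of_agree_fin (θ : Stage13Params F N) (D : Datum F N) (Dw : ReadingData F 𝔸 M) (γℓ : ℝ) {k : ℕ}
    (hT : TermlessBeyond (Dw.S k) k) (hD4 : ReadOutAt D (u3OfRecord₁₃ θ (Dw.u3Objects γℓ) k))
    {k' : ℕ} {v v' : Fin (k' + 1) → ℝ} (hv : v ∈ Box θ.γ k') (hv' : v' ∈ Box θ.γ k')
    (hag : ∀ i : Fin (k' + 1), (i : ℕ) < k → v i = v' i) : D.βfun k' v = D.βfun k' v' := by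
  refine beta_eq_of_readOutAt_runLevel θ D Dw γℓ hT hD4 hv hv' fun i hi => ?_
  unfold extd
  split_ifs with h
  · exact hag ⟨i, Nat.lt_succ_of_le h⟩ hi
  · exact hag (Fin.last k') (by rw [Fin.val_last]; omega)

/-- **AT RUN LENGTH 0: (D4) ⇒ THE DATUM's β IS CONSTANT ON EVERY BOX.** [folklore] -/
theorem boxwiseConstant_of_readOutAt_level_zero (θ : Stage13Params F N) (D : Datum F N) (Dw : ReadingData F 𝔸 M) (γℓ : ℝ)
    (hT : TermlessBeyond (Dw.S 0) 0) (hD4 : ReadOutAt D (u3OfRecord₁₃ θ (Dw.u3Objects γℓ) 0)) : BoxwiseConstant θ.γ D.βfun :=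
  fun _ _ _ hv hv' => beta_eq_of_readOutAt_runLevel θ D Dw γℓ hT hD4 hv hv' fun i hi => absurd hi (Nat.not_lt_zero i)

/-- **θ-FORM AT THE DATUM OF RECORD**: (D4) at the level-0 bundle of a run-tower reading at `datumOfRecord₁₃CoPH F N θ hP` makes `betaOfRecord₁₃` ([Balaban1987RG1] (1.20)–(1.22)
read at the Stage-13 tokens) constant on every box `]0,θ.γ]^{k′+1}` (`Node00.βfun_datumOfRecord₁₃CoPH`, `rfl`). [folklore] -/
theorem boxwiseConstant_betaOfRecord₁₃_of_readOutAt_level_zero (θ : Stage13HParams F N) (hP : θ.Provisos₁₃CoPH F N) (Dw : ReadingData F 𝔸 M) (γℓ : ℝ)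
    (hT : TermlessBeyond (Dw.S 0) 0) (hD4 : ReadOutAt (datumOfRecord₁₃CoPH F N θ hP) (u3OfRecord₁₃ θ.toStage13Params (Dw.u3Objects γℓ) 0)) :
    BoxwiseConstant θ.γ (betaOfRecord₁₃ F N θ.toStage13Params) := by
  have h := boxwiseConstant_of_readOutAt_level_zero θ.toStage13Params _ Dw γℓ hT hD4
  rwa [Node00.βfun_datumOfRecord₁₃CoPH] at h

/-- **θ-FORM AT A SELECTED RUN LENGTH `k`** (the v2 draft's `ksel`): (D4) at the level-`k` bundle of a run-tower reading at the datum of record makes `betaOfRecord₁₃ k′` blind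
to the coordinates `≥ k` at every step `k′`. [folklore] -/
theorem betaOfRecord₁₃_eq_of_readOutAt_runLevel (θ : Stage13HParams F N) (hP : θ.Provisos₁₃CoPH F N) (Dw : ReadingData F 𝔸 M) (γℓ : ℝ) {k : ℕ}
    (hT : TermlessBeyond (Dw.S k) k) (hD4 : ReadOutAt (datumOfRecord₁₃CoPH F N θ hP) (u3OfRecord₁₃ θ.toStage13Params (Dw.u3Objects γℓ) k))
    {k' : ℕ} {v v' : Fin (k' + 1) → ℝ} (hv : v ∈ Box θ.γ k') (hv' : v' ∈ Box θ.γ k') (hag : ∀ i : Fin (k' + 1), (i : ℕ) < k → v i = v' i) :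
    betaOfRecord₁₃ F N θ.toStage13Params k' v = betaOfRecord₁₃ F N θ.toStage13Params k' v' := by
  have h := beta_eq_of_readOutAt_runLevel_of_agree_fin θ.toStage13Params _ Dw γℓ hT hD4 hv hv' hag
  rwa [Node00.βfun_datumOfRecord₁₃CoPH] at h

/-- **★★ THE SEVENTH K4 STUB AT n22-e's READING OF RECORD WITH RUN TOWERS IS THE β-DEGENERACY SENTENCE**: `S_D4 (RRec₁₃CoPH (readingOfRecord₁₃CoPH w1 ℓ₃ ne2 ne1))` pins
EVERY run length — in particular `0`, whose level functional is zero — so at every Stage-13 datum key the datum's β is constant on every box.  (`hT` holds for every reading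
at `W1.runTowers S′`, `W1.termlessBeyond_runTowers S′ 0`.) [folklore] -/
theorem boxwiseConstant_of_s_D4_readingOfRecord₁₃CoPH
    (w1 : (F : T4Family) → (θ : Stage13HParams F N) → ReadingData F (MatA N) θ.τ9.M) (ℓ₃ : T4Family → NE3Letters₁₁)
    (ne2 : (F : T4Family) → Stage13HParams F N → (ℕ → ℝ) → List (ULoop F) → ℕ → NE2Objects₁₁)
    (ne1 : (F : T4Family) → Stage13HParams F N → (ℕ → ℝ) → List (ULoop F) → NE1pCarriers)
    (hT : ∀ (F : T4Family) (θ : Stage13HParams F N), TermlessBeyond ((w1 F θ).S 0) 0)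
    (hD4 : S_D4 (RRec₁₃CoPH (readingOfRecord₁₃CoPH w1 ℓ₃ ne2 ne1)))
    (F : T4Family) (D : Datum F N) (h : IsDatumOfRecord₁₃CCoPH F N D) : BoxwiseConstant h.params.γ D.βfun :=
  boxwiseConstant_of_readOutAt_level_zero h.params.toStage13Params D (w1 F h.params) h.params.γ (hT F h.params)
    ((s_D4_readingOfRecord₁₃CoPH_iff w1 ℓ₃ ne2 ne1).mp hD4 F D h 0)

end RunTowers

/-! ## §4 The record names of `EA ∕ EB` and the guard at the reading of record (faces, `rfl`) -/

section RecordNames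

variable {N : ℕ} [NeZero N]
  (w1 : (F : T4Family) → (θ : Stage13HParams F N) → ReadingData F (MatA N) θ.τ9.M) (ℓ₃ : T4Family → NE3Letters₁₁)
  (ne2 : (F : T4Family) → Stage13HParams F N → (ℕ → ℝ) → List (ULoop F) → ℕ → NE2Objects₁₁)
  (ne1 : (F : T4Family) → Stage13HParams F N → (ℕ → ℝ) → List (ULoop F) → NE1pCarriers)
  (F : T4Family) (θ : Stage13HParams F N) (hP : θ.Provisos₁₃CoPH F N) (g₀ : ℕ → ℝ) (os : List (ULoop F)) (k : ℕ)

/-- **RUN A's FUNCTIONAL OF RECORD at run length `k`, BY NAME**: `EA g U ⟨j, X⟩ = Re E^{(j)}(X; g₀,…,g_{j−1}; embA U)` — (2.13) of the tower `(w1 F θ).S k` read through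
the level pairing (`W1.functionalC`; `rfl`). [folklore] -/
theorem EA_readingOfRecord₁₃CoPH_apply (g : ℕ → ℝ) (U : ((w1 F θ).pairing k).BgA) (X : Node00.W1.Dom (F.P k) θ.τ9.M) :
    (rateCarriersOfRecord₁₃CoPH (readingOfRecord₁₃CoPH w1 ℓ₃ ne2 ne1) F θ hP g₀ os k).u3.EA g U X =
      (functionalC ((w1 F θ).S k) g (((w1 F θ).pairing k).embA U) X).re :=
  rfl

/-- **RUN B's FIRST-COUPLING FAMILY OF RECORD at run length `k`, BY NAME**: `EB b g U X = Re E_B(pair X; b∷g; embB U)` — (2.13) of the tower `(w1 F θ).S (k+1)` at the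
paired domain with the unpaired first coupling prepended (`rfl`). [folklore] -/
theorem EB_readingOfRecord₁₃CoPH_apply (b : ℝ) (g : ℕ → ℝ) (U : ((w1 F θ).pairing k).BgB) (X : Node00.W1.Dom (F.P k) θ.τ9.M) :
    (rateCarriersOfRecord₁₃CoPH (readingOfRecord₁₃CoPH w1 ℓ₃ ne2 ne1) F θ hP g₀ os k).u3.EB b g U X =
      (functionalC ((w1 F θ).S (k + 1)) (prependCoupling b g) (((w1 F θ).pairing k).embB U) (((w1 F θ).pairing k).pair X)).re :=
  rfl

/-- **THE GUARD AT THE READING OF RECORD, UNFOLDED**: the run-length-`k` bundle of record passes the guard iff SOME (2.13) term of the tower `(w1 F θ).S k`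
distinguishes two histories of one box `]0,θ.γ]^{k′+1}` at some run-A background and domain — a statement about the VALUES of the residual towers (content:
the record's term values; for a run tower only creation steps `1 ≤ j ≤ k` can contribute, §3). [folklore] -/
theorem sensitiveOnBoxes_readingOfRecord₁₃CoPH_iff :
    SensitiveOnBoxes (rateCarriersOfRecord₁₃CoPH (readingOfRecord₁₃CoPH w1 ℓ₃ ne2 ne1) F θ hP g₀ os k).u3.EA θ.γ ↔
      ∃ (k' : ℕ) (v v' : Fin (k' + 1) → ℝ), v ∈ Box θ.γ k' ∧ v' ∈ Box θ.γ k' ∧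
        ∃ (U : ((w1 F θ).pairing k).BgA) (X : Node00.W1.Dom (F.P k) θ.τ9.M),
          (functionalC ((w1 F θ).S k) (extd v) (((w1 F θ).pairing k).embA U) X).re ≠
            (functionalC ((w1 F θ).S k) (extd v') (((w1 F θ).pairing k).embA U) X).re := by
  constructor
  · rintro ⟨k', v, v', hv, hv', hne⟩
    obtain ⟨U, hU⟩ := Function.ne_iff.mp hne
    obtain ⟨X, hX⟩ := Function.ne_iff.mp hU
    exact ⟨k', v, v', hv, hv', U, X, hX⟩
  · rintro ⟨k', v, v', hv, hv', U, X, hX⟩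
    exact ⟨k', v, v', hv, hv', Function.ne_iff.mpr ⟨U, Function.ne_iff.mpr ⟨X, hX⟩⟩⟩

end RecordNames

end YMDAG.N18.U3Guards

end
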